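import Summits.NavierStokesRegularity.FluidComputer.DesignedBlowupResidual
import Literature.Analysis.FluidPDE.NSEnstrophyPersistenceForced
import Literature.Analysis.FluidPDE.TaoLocalisationProofs
import HarnessLib

/-!
# Spatial regularity of a designed forced blow-up is FACT-FREE, and the generic E–C closer
# without the slab sup-bound hypothesis

Cell `ns-blowup`, seat `ns-blowup-ecbridge-2` (g4; the E–C endpoint theory seat). LABEL: E–C typing
(KERNEL, no named fact; two constructors `DesignedBlowup.ofEnergy`, `DesignedBlowup.ofEnergyUnboundedOn`).
WHAT THIS IS NOT: not Navier–Stokes evidence — `DesignedBlowup ν` is a TYPE with no asserted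
inhabitant; nothing is constructed. Companion memo: `run/shared/lean/pub/ns-blowup/ecbridge2/ECBRIDGE-2-MEMO-3.md`.

## Content

Since 2026-08-26 07:28Z the tree holds lit g10's theorem
`IsClassicalNSSolutionOn.hasBoundedSobolevNormsOn_of_clayForce` (`NSEnstrophyPersistenceForced.lean`;
Tao 2013 Cor. 11.1 + Cor. 4.3 + Thm. 5.4 (iv) WITH force, the `u`-clause of the named fact
`tao2011_hasBoundedSobolevNormsOn_forced`, FACT-FREE): a finite-energy classical solution of the
forced system on a closed slab with Schwartz datum and Clay force has ALL spatial `L²` Sobolev norms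
bounded on the slab. Read on the generic E–C object `DesignedBlowup ν` of `DesignedBlowupClayBridge.lean`:

* `DesignedBlowup.hasBoundedSobolevNormsOn` — on every closed sub-slab `[0, T']`, `T' < T`, the
  designed velocity lies in Tao's class `L^∞_t H^k_x` for every `k` (the hypothesis `hu` of the
  Serrin-divergence tests of `DesignedBlowupSerrinDivergence.lean`, now discharged);
* `DesignedBlowup.exists_norm_le` — hence is BOUNDED on every closed sub-slab (Sobolev imbedding
  `H² ⊂ C_B`, tree theorem `linfty_bound_of_hasBoundedSobolevNormsOn_holds`) — i.e. the structure's
  field `bounded` is REDUNDANT for `ν > 0`;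
* `DesignedBlowup.ofEnergy` / `DesignedBlowup.ofEnergyUnboundedOn` — constructors WITHOUT the
  `bounded` field: classical on `[0, T)`, maximal at `T` (resp. a compact pointwise blow-up witness),
  Clay datum, Clay force, finite energy on closed sub-slabs — nothing else;
* `navierStokesBreakdownR3_of_designedBlowup_energy`, `navierStokesBreakdownR3_of_clayResidual_energy`
  — **the generic E–C closer and the door (β′) with one hypothesis fewer**: Fefferman's (C) from ONE
  smooth divergence-free pair at ONE viscosity `μ > 0` with Clay datum and finite energy on closed
  sub-slabs, unbounded on `[0, T) × K` for a compact `K`, whose Navier–Stokes residual is the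
  restriction of a Clay-class field. No stability theorem, no named fact, no sup bound to verify.

References: T. Tao, Anal. PDE 6 (2013) = arXiv:1108.1165, Cor. 11.1, Cor. 4.3, Thm. 5.4 (iv)
[cite: Tao2011, Cor. 11.1]; R. A. Adams, J. J. F. Fournier, *Sobolev Spaces* (2003), Thm. 4.12
[cite: AdamsFournier2003, Thm. 4.12]; C. L. Fefferman, Clay problem description, (C)
[cite: FeffermanClay2006, (C)].
-/

noncomputable section

namespace Summit.NavierStokesRegularity.FluidComputer

open Set MeasureTheory Filter Topology Function
open scoped ENNReal NNReal
open Literature.Analysis.FluidPDE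

namespace DesignedBlowup

variable {ν : ℝ} (D : DesignedBlowup ν)

/-! ## §1 Tao's spatial class on every closed sub-slab, fact-free -/

/-- **A designed blow-up lies in Tao's class `L^∞_t H^k_x([0,T'] × ℝ³)` for every `k` and every
`0 < T' < T`** (`ν > 0`): lit g10's theorem `hasBoundedSobolevNormsOn_of_clayForce` on the closed
sub-slab, fed with the structure's classicality, slab energy, Clay datum and Clay force. No named
fact. [cite: Tao2011, Cor. 11.1] -/
theorem hasBoundedSobolevNormsOn (hν : 0 < ν) {T' : ℝ} (hT'0 : 0 < T') (hT' : T' < D.T) :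
    HasBoundedSobolevNormsOn (Icc 0 T') D.u := by
  obtain ⟨C, hCt, hC⟩ := D.energy T' hT'
  exact (D.classical.mono (Icc_subset_Ico_right hT') (uniqueDiffOn_Icc hT'0)).hasBoundedSobolevNormsOn_of_clayForce
    hν hT'0 ⟨C.toNNReal, fun t ht => (hC t ht).trans (ENNReal.coe_toNNReal hCt.ne).ge⟩
    D.datum_decay D.force_smooth D.force_decay

/-- The same in the slab-quantified form consumed by the Serrin-divergence tests
(`DesignedBlowupSerrinDivergence.lean`, hypothesis `hu`). [cite: Tao2011, Cor. 11.1] -/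
theorem hasBoundedSobolevNormsOn_subslabs (hν : 0 < ν) :
    ∀ T' ∈ Ioo 0 D.T, HasBoundedSobolevNormsOn (Icc 0 T') D.u :=
  fun _ hT' => D.hasBoundedSobolevNormsOn hν hT'.1 hT'.2

/-- **A designed blow-up is bounded on every closed sub-slab — from the energy alone** (`ν > 0`;
Sobolev imbedding `H²(ℝ³) ⊂ C_B(ℝ³)`, tree theorem `linfty_bound_of_hasBoundedSobolevNormsOn_holds`, on
the class of `hasBoundedSobolevNormsOn`). The field `bounded` of the structure is therefore
redundant for positive viscosity. No named fact. [cite: AdamsFournier2003, Thm. 4.12] -/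
theorem exists_norm_le (hν : 0 < ν) {T' : ℝ} (hT' : T' < D.T) :
    ∃ B : ℝ, ∀ t ∈ Icc 0 T', ∀ x, ‖D.u t x‖ ≤ B := by
  rcases lt_or_ge 0 T' with hT'0 | hT'0
  · exact linfty_bound_of_hasBoundedSobolevNormsOn_holds
      (fun t ht => contDiff_infty.1 (D.classical.contDiff_velocity ⟨ht.1, lt_of_le_of_lt ht.2 hT'⟩) 2)
      (D.hasBoundedSobolevNormsOn hν hT'0 hT')
  · -- degenerate slab `[0, T']`, `T' ≤ 0`: at most the single slice `t = 0`
    obtain ⟨B, hB⟩ := linfty_bound_of_hasBoundedSobolevNormsOn_holds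
      (fun t ht => contDiff_infty.1
        (D.classical.contDiff_velocity ⟨ht.1, lt_of_le_of_lt ht.2 (half_lt_self D.T_pos)⟩) 2)
      (D.hasBoundedSobolevNormsOn hν (half_pos D.T_pos) (half_lt_self D.T_pos))
    exact ⟨B, fun t ht x => hB t ⟨ht.1, ht.2.trans (hT'0.trans (half_pos D.T_pos).le)⟩ x⟩

end DesignedBlowup

/-! ## §2 Constructors without the sup-bound field -/

/-- The sup bound on closed sub-slabs of a classical forced solution on `[0, T)` with finite slab
energies, Schwartz datum and Clay force (`ν > 0`) — the computation behind
`DesignedBlowup.exists_norm_le`, stated for raw fields so that it can feed the structure's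
constructor. No named fact. [cite: Tao2011, Cor. 11.1] [cite: AdamsFournier2003, Thm. 4.12] -/
theorem exists_norm_le_of_energy {ν : ℝ} (hν : 0 < ν) {T : ℝ} (hT : 0 < T)
    {u f : ℝ → EuclideanSpace ℝ (Fin 3) → EuclideanSpace ℝ (Fin 3)}
    {p : ℝ → EuclideanSpace ℝ (Fin 3) → ℝ}
    (hsol : IsClassicalNSSolutionOn (Ico 0 T) ν f u p)
    (h₀ : HasRapidSpatialDecay (u 0)) (hfs : IsSmoothOnHalfSpace f) (hfd : HasRapidSpaceTimeDecay f)
    (energy : ∀ T', T' < T → ∃ C : ℝ≥0∞, C < ⊤ ∧ ∀ t ∈ Icc 0 T', ∫⁻ x, ‖u t x‖ₑ ^ 2 ≤ C) :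
    ∀ T', T' < T → ∃ B : ℝ, ∀ t ∈ Icc 0 T', ∀ x, ‖u t x‖ ≤ B := by
  -- Tao's class on a closed sub-slab `[0, T']`, `0 < T' < T`
  have hTao : ∀ T', 0 < T' → T' < T → HasBoundedSobolevNormsOn (Icc 0 T') u := by
    intro T' hT'0 hT'
    obtain ⟨C, hCt, hC⟩ := energy T' hT'
    exact (hsol.mono (Icc_subset_Ico_right hT') (uniqueDiffOn_Icc hT'0)).hasBoundedSobolevNormsOn_of_clayForce
      hν hT'0 ⟨C.toNNReal, fun t ht => (hC t ht).trans (ENNReal.coe_toNNReal hCt.ne).ge⟩ h₀ hfs hfd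
  have hC2 : ∀ T', T' < T → ∀ t ∈ Icc 0 T', ContDiff ℝ 2 (u t) := fun T' hT' t ht =>
    contDiff_infty.1 (hsol.contDiff_velocity ⟨ht.1, lt_of_le_of_lt ht.2 hT'⟩) 2
  intro T' hT'
  rcases lt_or_ge 0 T' with hT'0 | hT'0
  · exact linfty_bound_of_hasBoundedSobolevNormsOn_holds (hC2 T' hT') (hTao T' hT'0 hT')
  · obtain ⟨B, hB⟩ := linfty_bound_of_hasBoundedSobolevNormsOn_holds (hC2 _ (half_lt_self hT))
      (hTao _ (half_pos hT) (half_lt_self hT))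
    exact ⟨B, fun t ht x => hB t ⟨ht.1, ht.2.trans (hT'0.trans (half_pos hT).le)⟩ x⟩

namespace DesignedBlowup

/-- **Constructor without the sup-bound field** (`ν > 0`): a classical forced solution on `[0, T)`
admitting no classical extension past `T`, with Clay datum, Clay force and finite energy on every
closed sub-slab, IS a designed blow-up — its slab sup bounds come from Tao's class
(`exists_norm_le_of_energy`). [cite: FeffermanClay2006, (C)] [cite: Tao2011, Cor. 11.1] -/
def ofEnergy {ν : ℝ} (hν : 0 < ν) (T : ℝ) (T_pos : 0 < T)
    (u : ℝ → EuclideanSpace ℝ (Fin 3) → EuclideanSpace ℝ (Fin 3))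
    (p : ℝ → EuclideanSpace ℝ (Fin 3) → ℝ)
    (f : ℝ → EuclideanSpace ℝ (Fin 3) → EuclideanSpace ℝ (Fin 3))
    (classical : IsClassicalNSSolutionOn (Ico 0 T) ν f u p)
    (no_extension : ¬ HasSmoothExtensionPast ν f u T)
    (datum_decay : HasRapidSpatialDecay (u 0)) (force_smooth : IsSmoothOnHalfSpace f)
    (force_decay : HasRapidSpaceTimeDecay f)
    (energy : ∀ T', T' < T → ∃ C : ℝ≥0∞, C < ⊤ ∧ ∀ t ∈ Icc 0 T', ∫⁻ x, ‖u t x‖ₑ ^ 2 ≤ C) :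
    DesignedBlowup ν where
  T := T
  T_pos := T_pos
  u := u
  p := p
  f := f
  classical := classical
  no_extension := no_extension
  datum_decay := datum_decay
  force_smooth := force_smooth
  force_decay := force_decay
  energy := energy
  bounded := exists_norm_le_of_energy hν T_pos classical datum_decay force_smooth force_decay energy

/-- **Constructor without the sup-bound field, from a pointwise blow-up witness** (`u` unbounded on
`[0, T) × K`, `K` compact; maximality by `not_hasSmoothExtensionPast_of_unboundedOn`).
[cite: FeffermanClay2006, (C)] [cite: Tao2011, Cor. 11.1] -/
def ofEnergyUnboundedOn {ν : ℝ} (hν : 0 < ν) (T : ℝ) (T_pos : 0 < T)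
    (u : ℝ → EuclideanSpace ℝ (Fin 3) → EuclideanSpace ℝ (Fin 3))
    (p : ℝ → EuclideanSpace ℝ (Fin 3) → ℝ)
    (f : ℝ → EuclideanSpace ℝ (Fin 3) → EuclideanSpace ℝ (Fin 3))
    (classical : IsClassicalNSSolutionOn (Ico 0 T) ν f u p)
    (K : Set (EuclideanSpace ℝ (Fin 3))) (hK : IsCompact K)
    (unbounded : ∀ M : ℝ, ∃ t ∈ Ico 0 T, ∃ x ∈ K, M < ‖u t x‖)
    (datum_decay : HasRapidSpatialDecay (u 0)) (force_smooth : IsSmoothOnHalfSpace f)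
    (force_decay : HasRapidSpaceTimeDecay f)
    (energy : ∀ T', T' < T → ∃ C : ℝ≥0∞, C < ⊤ ∧ ∀ t ∈ Icc 0 T', ∫⁻ x, ‖u t x‖ₑ ^ 2 ≤ C) :
    DesignedBlowup ν :=
  ofEnergy hν T T_pos u p f classical (not_hasSmoothExtensionPast_of_unboundedOn hK unbounded)
    datum_decay force_smooth force_decay energy

end DesignedBlowup

/-! ## §3 The closer and the door (β′), one hypothesis fewer -/

/-- **THE GENERIC E–C CLOSER WITHOUT THE SUP BOUND**: Fefferman's (C) from ONE classical forced
solution on `[0, T)` at ONE viscosity `μ > 0`, maximal at `T`, with Clay datum, Clay force and finite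
energy on closed sub-slabs. [cite: FeffermanClay2006, (C)] -/
theorem navierStokesBreakdownR3_of_designedBlowup_energy {μ : ℝ} (hμ : 0 < μ) {T : ℝ} (hT : 0 < T)
    {u f : ℝ → EuclideanSpace ℝ (Fin 3) → EuclideanSpace ℝ (Fin 3)}
    {p : ℝ → EuclideanSpace ℝ (Fin 3) → ℝ}
    (classical : IsClassicalNSSolutionOn (Ico 0 T) μ f u p)
    (no_extension : ¬ HasSmoothExtensionPast μ f u T)
    (datum_decay : HasRapidSpatialDecay (u 0)) (force_smooth : IsSmoothOnHalfSpace f)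
    (force_decay : HasRapidSpaceTimeDecay f)
    (energy : ∀ T', T' < T → ∃ C : ℝ≥0∞, C < ⊤ ∧ ∀ t ∈ Icc 0 T', ∫⁻ x, ‖u t x‖ₑ ^ 2 ≤ C) :
    Summit.NavierStokesRegularity.NavierStokesRegularity.NavierStokesBreakdownR3 :=
  navierStokesBreakdownR3_of_designedBlowup hμ
    (DesignedBlowup.ofEnergy hμ T hT u p f classical no_extension datum_decay force_smooth force_decay
      energy)

/-- **THE DOOR (β′) WITHOUT THE SUP BOUND**: Fefferman's (C) from ONE smooth divergence-free pair
`(U, P)` on `[0, T) × ℝ³` at ONE viscosity `μ > 0`, with Clay datum and finite energy on closed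
sub-slabs, UNBOUNDED on `[0, T) × K` for a compact `K`, whose Navier–Stokes residual
`∂ₜU + (U·∇)U − μΔU + ∇P` is the restriction of a Clay-class field `F` (smooth on the closed
half-space, through `T`, with decay (5)). No stability theorem, no named fact, no sup bound.
[cite: FeffermanClay2006, (C)] -/
theorem navierStokesBreakdownR3_of_clayResidual_energy {μ : ℝ} (hμ : 0 < μ) {T : ℝ} (hT : 0 < T)
    {U : ℝ → EuclideanSpace ℝ (Fin 3) → EuclideanSpace ℝ (Fin 3)}
    {P : ℝ → EuclideanSpace ℝ (Fin 3) → ℝ}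
    {F : ℝ → EuclideanSpace ℝ (Fin 3) → EuclideanSpace ℝ (Fin 3)}
    (hU : IsSmoothSpaceTimeOn (Ico 0 T) U) (hP : IsSmoothSpaceTimeOn (Ico 0 T) P)
    (hdiv : ∀ t ∈ Ico 0 T, VectorCalculus.IsDivFree (U t))
    (hFs : IsSmoothOnHalfSpace F) (hFd : HasRapidSpaceTimeDecay F)
    (hres : ∀ t ∈ Ico 0 T, ∀ x, F t x = nsResidual (Ico 0 T) μ U P t x)
    {K : Set (EuclideanSpace ℝ (Fin 3))} (hK : IsCompact K)
    (unbounded : ∀ M : ℝ, ∃ t ∈ Ico 0 T, ∃ x ∈ K, M < ‖U t x‖)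
    (datum_decay : HasRapidSpatialDecay (U 0))
    (energy : ∀ T', T' < T → ∃ C : ℝ≥0∞, C < ⊤ ∧ ∀ t ∈ Icc 0 T', ∫⁻ x, ‖U t x‖ₑ ^ 2 ≤ C) :
    Summit.NavierStokesRegularity.NavierStokesRegularity.NavierStokesBreakdownR3 :=
  navierStokesBreakdownR3_of_designedBlowup hμ
    (DesignedBlowup.ofEnergyUnboundedOn hμ T hT U P F
      (isClassicalNSSolutionOn_of_eq_nsResidual hU hP hdiv hres) K hK unbounded datum_decay hFs hFd
      energy)

end Summit.NavierStokesRegularity.FluidComputer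

end
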